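import Summits.BirchSwinnertonDyer.BirchSwinnertonDyer.Theorems.CountingDoorF2AtThreeSelmerAverageSieve
import Summits.BirchSwinnertonDyer.Rank2.F2DensityAlgebra
import Literature.NumberTheory.EllipticCurves.BSDWave0Proofs
import HarnessLib

/-!
# BirchSwinnertonDyer / CountingDoorF2AtThree — crux I1 `SelmerThreeAverageLargeF2`
# (stmt-BirchSwinnertonDyer-19440) BY NAME: the nonempty-residue reduction and the FLOOR of the constant

Companion of `Theorems/CountingDoorF2AtThreeSelmerAverageNotWithoutLarge.lean` (p594051: the hypothesis
`IsLarge` of I1 is load-bearing). Two further statements about the SHAPE of the crux, both over the route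
decl by name:

* §1 `selmerThreeAverageLargeF2_iff_residues_nonempty`: I1 is EQUIVALENT to its restriction to large
  families with a nonempty residue set at every prime (a family with an empty residue set at some prime
  has no member, so every average is the junk value `0`: tree `averageOnLE_of_residues_eq_empty`, Sieve
  file). Hence the sentence refuted in p594051's
  `not_selmerThreeAverage_of_residues_nonempty_without_isLarge` is exactly «I1 with `IsLarge` deleted».
* §2 THE FLOOR (modulo the route's fact pack `LargeFamilyInputsF2` = Bhargava–Ho Thm 10.1 ∧ Thm 9.1, the
  two named Literature facts `thm10_1_F2`, `thm9_1_F2`): on every large `Φ` with nonempty residues the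
  `3`-Selmer average cannot have limsup below `9` — `not_averageOnLE_selmerThree_of_lt_nine` — because
  100 % of the members have trivial torsion and rank `≥ 2` (`thm9_1_F2.hasDensityOn_torsionOrder_rank_of_isLarge`),
  hence `#Sel₃ ≥ 3^rank ≥ 9` (Kummer, `WeierstrassCurve.pow_rank_le_card_selmerGroup`). In particular the
  constant `36` of I1 cannot be replaced by any `c < 9` (`not_selmerThreeAverageLargeF2_const_lt_nine`,
  witnessed on the whole family `F₂`). With p582870 (instrument) and p594051 (hypothesis hygiene) this
  brackets the crux: `IsLarge` necessary; constant in `[9, 36]` is the open window (heuristic floor under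
  root-number equidistribution: `(9 + 27)/2 = 18`, not provable here).

HONEST FRAMING (B1). Bookkeeping over two published facts about an OPEN crux; I1 is neither proved nor
refuted; nothing reads an analytic rank; no S0 motion; BSD is not proved by any of this. PARTITION: none —
r_an ≥ 2, summit axis S0; TWIN (D-0056): n/a.

References: M. Bhargava, W. Ho, arXiv:2207.03309 (2022), Thm. 9.1, Thm. 10.1 [BhargavaHo2022]; J. Silverman,
AEC X.4.2 [SilvermanAEC2009].
-/

set_option linter.dupNamespace false

noncomputable section

open scoped Classical
open Filter Topology Finset
open WeierstrassCurve Literature.NumberTheory.EllipticCurves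
  Literature.NumberTheory.EllipticCurves.BhargavaHo2022
  Summit.BirchSwinnertonDyer.Rank2
  Summit.BirchSwinnertonDyer.BirchSwinnertonDyer.Theses.CountingDoorF2AtThree

namespace Summit.BirchSwinnertonDyer.BirchSwinnertonDyer.Theorems

/-! ### §1 Empty residue sets are vacuous: I1 ↔ I1 on families with nonempty residues -/

/-- **I1 is equivalent to its restriction to large families with a nonempty residue set at every prime.**
So «I1 with `IsLarge` deleted» is exactly the sentence `∀ Φ, (∀ p prime, (Φ.residues p).Nonempty) →
Φ.AverageOnLE #Sel₃ 36` refuted (without `IsLarge`) in p594051.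
[cite: BhargavaHo2022, §1 (large subfamilies; Thm. 1.2 shape)] -/
theorem selmerThreeAverageLargeF2_iff_residues_nonempty :
    SelmerThreeAverageLargeF2 ↔ ∀ Φ : CongruenceFamily₂, Φ.IsLarge →
      (∀ p : ℕ, p.Prime → (Φ.residues p).Nonempty) →
        Φ.AverageOnLE (fun a ↦ (Nat.card (a.curve.selmerGroup 3) : ℝ)) 36 := by
  refine ⟨fun h Φ hΦ _ ↦ h Φ hΦ, fun h Φ hΦ ↦ ?_⟩
  by_cases hne : ∀ p : ℕ, p.Prime → (Φ.residues p).Nonempty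
  · exact h Φ hΦ hne
  · simp only [not_forall] at hne
    obtain ⟨p, hp, he⟩ := hne
    exact averageOnLE_of_residues_eq_empty Φ hp (Set.not_nonempty_iff_eq_empty.mp he) _ (by norm_num)

/-! ### §2 The floor: no limsup below `9` on a large family (modulo Bhargava–Ho Thm 9.1 / 10.1) -/

/-- Averages are linear in a scalar: `avg (c·1_P) = c · prop(P)`. [folklore] -/
theorem averageOn_const_mul_indicator (Φ : CongruenceFamily₂) (P : Params → Prop) (c : ℝ) (X : ℕ) :
    Φ.averageOn (fun a ↦ c * (if P a then 1 else 0)) X = c * Φ.proportionOn P X := by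
  rw [proportionOn_eq_averageOn, averageOn_eq_sum_div, averageOn_eq_sum_div, ← Finset.mul_sum,
    mul_div_assoc]

/-- Member-wise, a generic member (trivial torsion — unused — and rank `≥ 2`) has `#Sel₃ ≥ 9`:
`9 ≤ 3^rank ≤ #Sel₃` (Kummer injection). [cite: SilvermanAEC2009, Thm X.4.2] -/
theorem nine_le_natCard_selmerGroup_of_two_le_rank (a : Params) (ha : a.IsMember)
    (h2 : 2 ≤ a.curve.mordellWeilRank) : (9 : ℝ) ≤ (Nat.card (a.curve.selmerGroup 3) : ℝ) := by
  haveI := Params.isElliptic_curve ha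
  have h₀ := a.curve.pow_rank_le_card_selmerGroup (n := 3) (by norm_num)
  have h : (3 : ℝ) ^ a.curve.mordellWeilRank ≤ (Nat.card (a.curve.selmerGroup 3) : ℝ) := by
    exact_mod_cast h₀
  have h9 : (3 : ℝ) ^ 2 ≤ (3 : ℝ) ^ a.curve.mordellWeilRank := pow_le_pow_right₀ (by norm_num) h2
  linarith [show (3 : ℝ) ^ 2 = 9 by norm_num]

/-- On any family, the `3`-Selmer average dominates `9 ×` the proportion of rank-`≥ 2` members.
[cite: SilvermanAEC2009, Thm X.4.2] -/
theorem nine_mul_proportionOn_le_averageOn_selmerThree (Φ : CongruenceFamily₂) (X : ℕ) :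
    9 * Φ.proportionOn (fun a ↦ a.curve.torsionOrder = 1 ∧ 2 ≤ a.curve.mordellWeilRank) X ≤
      Φ.averageOn (fun a ↦ (Nat.card (a.curve.selmerGroup 3) : ℝ)) X := by
  rw [← averageOn_const_mul_indicator]
  refine averageOn_mono Φ (fun a ha ↦ ?_) X
  by_cases hP : a.curve.torsionOrder = 1 ∧ 2 ≤ a.curve.mordellWeilRank
  · rw [if_pos hP, mul_one]
    exact nine_le_natCard_selmerGroup_of_two_le_rank a ha.1 hP.2
  · rw [if_neg hP, mul_zero]
    exact Nat.cast_nonneg _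

/-- **The floor.** Modulo the fact pack `LargeFamilyInputsF2` (= `thm10_1_F2 ∧ thm9_1_F2`): on every large
`Φ ⊆ F₂` with a nonempty residue set at every prime, `Φ.AverageOnLE #Sel₃ c` FAILS for every `c < 9`
(100 % of members have rank `≥ 2`, so the finite averages are eventually `≥ 9(1 − δ)`).
[cite: BhargavaHo2022, Thm. 10.1 and Thm. 9.1] -/
theorem not_averageOnLE_selmerThree_of_lt_nine (hL : LargeFamilyInputsF2) (Φ : CongruenceFamily₂)
    (hΦ : Φ.IsLarge) (hne : ∀ p : ℕ, p.Prime → (Φ.residues p).Nonempty) {c : ℝ} (hc : c < 9) :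
    ¬ Φ.AverageOnLE (fun a ↦ (Nat.card (a.curve.selmerGroup 3) : ℝ)) c := by
  intro h
  have hgen : Φ.HasDensityOn (fun a ↦ a.curve.torsionOrder = 1 ∧ 2 ≤ a.curve.mordellWeilRank) 1 :=
    thm9_1_F2.hasDensityOn_torsionOrder_rank_of_isLarge hL.2 hL.1 Φ hΦ hne
  have hD := densityOnGE_of_hasDensityOn Φ hgen ((9 - c) / 36) (by linarith)
  obtain ⟨X, hX₁, hX₂⟩ := ((h ((9 - c) / 4) (by linarith)).and hD).exists
  have hfloor := nine_mul_proportionOn_le_averageOn_selmerThree Φ X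
  linarith

/-- **I1's constant cannot go below `9`** (modulo `LargeFamilyInputsF2`): for every `c < 9` the sentence
`∀ Φ, Φ.IsLarge → Φ.AverageOnLE #Sel₃ c` is false — witnessed on the whole family `F₂`
(`CongruenceFamily₂.all`: large, every residue set is `univ`). [cite: BhargavaHo2022, Thm. 10.1 and Thm. 9.1] -/
theorem not_selmerThreeAverageLargeF2_const_lt_nine (hL : LargeFamilyInputsF2) {c : ℝ} (hc : c < 9) :
    ¬ ∀ Φ : CongruenceFamily₂, Φ.IsLarge →
      Φ.AverageOnLE (fun a ↦ (Nat.card (a.curve.selmerGroup 3) : ℝ)) c := fun h ↦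
  not_averageOnLE_selmerThree_of_lt_nine hL CongruenceFamily₂.all CongruenceFamily₂.isLarge_all
    (fun _ _ ↦ ⟨((0 : ZMod _), (0 : ZMod _), (0 : ZMod _), (0 : ZMod _)), Set.mem_univ _⟩) hc
    (h _ CongruenceFamily₂.isLarge_all)

/-- The window this leaves for the crux, BY NAME: `SelmerThreeAverageLargeF2` asserts the limsup bound `36`
on every large `Φ`; modulo `LargeFamilyInputsF2` no bound `< 9` can hold on a large `Φ` with nonempty
residues, so on such `Φ` I1 pins `limsup avg #Sel₃` into `[9, 36]`. Stated as: I1 and the fact pack give,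
for every large `Φ` with nonempty residues and every `ε > 0`, infinitely many height bounds `X` with
`9 - ε ≤ avg ≤ 36 + ε`. [cite: BhargavaHo2022, Thm. 1.1/1.2 (shape), Thm. 9.1, Thm. 10.1] -/
theorem selmerThreeAverage_window (hL : LargeFamilyInputsF2) (h1 : SelmerThreeAverageLargeF2)
    (Φ : CongruenceFamily₂) (hΦ : Φ.IsLarge) (hne : ∀ p : ℕ, p.Prime → (Φ.residues p).Nonempty)
    {ε : ℝ} (hε : 0 < ε) :
    ∀ᶠ X : ℕ in atTop, 9 - ε ≤ Φ.averageOn (fun a ↦ (Nat.card (a.curve.selmerGroup 3) : ℝ)) X ∧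
      Φ.averageOn (fun a ↦ (Nat.card (a.curve.selmerGroup 3) : ℝ)) X ≤ 36 + ε := by
  have hgen : Φ.HasDensityOn (fun a ↦ a.curve.torsionOrder = 1 ∧ 2 ≤ a.curve.mordellWeilRank) 1 :=
    thm9_1_F2.hasDensityOn_torsionOrder_rank_of_isLarge hL.2 hL.1 Φ hΦ hne
  have hD := densityOnGE_of_hasDensityOn Φ hgen (ε / 9) (by positivity)
  refine (hD.and (h1 Φ hΦ ε hε)).mono fun X ⟨hX₁, hX₂⟩ ↦ ⟨?_, hX₂⟩
  have hfloor := nine_mul_proportionOn_le_averageOn_selmerThree Φ X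
  linarith

end Summit.BirchSwinnertonDyer.BirchSwinnertonDyer.Theorems

end
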